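import Summits.ABC.Analytic.RequirementsCongruence
import Literature.NumberTheory.EllipticCurves.CongruenceNumber
import Literature.NumberTheory.Automorphic.ShimuraCurveRibetTakahashiOptimalModularityProofs
import HarnessLib
import HarnessLib.Audit

/-!
# ABC — analytic / modular lens: LOWER bounds for the modular degree and the congruence number (proof-only)

Cell `abc-an` (C1), seat `pr-1` (KEY PR-THMDOORS «theorem-shaped doors — congruence-number lower bounds», THMDOOR-2
as named by the plan seat 2026-08-27T18:16Z). THEOREMS ONLY: the unconditional LOWER companions of the conjectural
UPPER doors R1 (`PolyModularDegreeRat K`) and R4 (`PolyCongruenceNumberRat K`) of `Requirements` /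
`RequirementsCongruence`, with the KNOWN named facts used (Hoffstein–Lockhart `murty_petersson_newform_lower_bound`,
Ribet `modularDegree_dvd_congruenceNumber`) as explicit hypotheses, and hypothesis-free variants from the PROVED
Petersson bound with exponent `1 − θ`, `θ > ½`.

HONESTY: abc is not proved by any of this; these are unconditional inequalities going the OTHER way from the doors
(they certify the window `K ≥ 1` of R1/R4 beside the landed floors, and are the baseline the `n′_f`-growth engine
ENG-MSYM measures against). A-PS itself is **NOT abc — «NOT abc — POLY-SZPIRO(E)»** (D-0139/D-0140).

## Contents
* `neg_four_thirds_lt_faltingsHeight`: `h_F(E) > −4/3` for every `E/ℚ` (PROVED `faltingsArchTerm_lt_sixteen`).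
* `log_modularDegree_ge_of_petersson`: `(1−ε) log N + 2 h_F(E) − C(ε) ≤ log deg φ_D` mod HL — the tree's
  `two_mul_faltingsHeight_le_of_petersson` (Zagier + `c² ≥ 1`) rearranged; `log_modularDegree_ge_of_half_lt`: the
  same with `1 − θ`, `θ > ½`, HYPOTHESIS-FREE (`HoffsteinLockhart1994_peterssonProduct_lower_bound_of_half_lt`).
* `log_modularDegree_ge_abs_of_petersson` / `_of_half_lt`: `deg φ ≫ N^{1−ε}` mod HL, `≫ N^{1−θ}` unconditionally.
* `log_congruenceNumber_ge_of_petersson`: `log r_f ≥ (1−ε) log N_E − C(ε)` mod HL + Ribet, via the optimal datum on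
  a globally minimal model (`exists_optimal_modularParametrizationData_of_isNewformOf'`, Edixhoven PROVED — no
  modularity input) and `r_f > 0` (`congruenceNumber_pos_of_datum`); `log_congruenceNumber_ge_of_half_lt`: mod Ribet
  only, exponent `1 − θ`.

References: [ZagierCMB1985] §1; [HoffsteinLockhart1994]; [MurtyCongruencePrimes1999] §2; [AgasheRibetStein2012]
Thm. 2.1; [Iwaniec2002] Thm. 8.3; [PastenShimura2024] §18.1 Lemma 18.1; [Silverman1986] Prop. 1.1.
-/

noncomputable section

open scoped MatrixGroups ModularForm Classical

namespace Summit.ABC.Analytic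

open Literature.NumberTheory.EllipticCurves Literature.NumberTheory.EllipticCurves.ModularForms
open CongruenceSubgroup WeierstrassCurve

/-! ## THMDOOR-2: the LOWER counterparts of the conjectural upper doors R1 / R4 (PROVED) -/

section LowerBounds

/-- **`h_F(E) > −4/3` for every elliptic curve over `ℚ`** (the tree's height `faltingsHeight`, Faltings–Silverman
normalisation): `12 h_F = log|Δ_min| − archTerm` (`faltingsHeight_rat`) with `log|Δ_min| ≥ 0` and
`archTerm < 16` (PROVED `faltingsArchTerm_lt_sixteen`, Pasten 2024 Lemma 18.1). Deligne's sharp value is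
`h_F(j=0) = −1.3211…`. [cite: PastenShimura2024, §18.1 Lemma 18.1] [cite: Silverman1986, Prop. 1.1] -/
theorem neg_four_thirds_lt_faltingsHeight (W : WeierstrassCurve ℚ) [W.IsElliptic] :
    -(4 / 3 : ℝ) < W.faltingsHeight := by
  haveI : (W.baseChange ℂ).IsElliptic := by rw [baseChange]; infer_instance
  rw [faltingsHeight_rat]
  have h1 := faltingsArchTerm_lt_sixteen (W.baseChange ℂ)
  have h2 : (0 : ℝ) ≤ Real.log (W.minimalDiscriminantNorm ℤ : ℕ) := Real.log_natCast_nonneg _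
  nlinarith

variable {N : ℕ} [NeZero N]

/-- **THMDOOR-2a: the modular degree is bounded BELOW by the height**, modulo Hoffstein–Lockhart
(`murty_petersson_newform_lower_bound`, `(f,f) ≫_ε N^{1−ε}`): for every `ε > 0` there is `C(ε)` with
`(1 − ε) log N + 2 h_F(E) − C ≤ log deg φ_D` for every globally minimal elliptic `W/ℚ` and every datum `D` at any
level `N` — the tree's `two_mul_faltingsHeight_le_of_petersson` (Zagier + `c² ≥ 1`) REARRANGED, not re-derived.
The unconditional-mod-HL LOWER companion of the conjectural UPPER door `PolyModularDegreeRat K` (it certifies the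
window `K ≥ 1` there, beside the landed floor `¬ PolyModularDegreeRat K` for `K < 2` mod HL). NOT abc.
[cite: ZagierCMB1985, §1] [cite: MurtyCongruencePrimes1999, §2] [cite: HoffsteinLockhart1994] -/
theorem log_modularDegree_ge_of_petersson (hP : murty_petersson_newform_lower_bound) {ε : ℝ} (hε : 0 < ε) :
    ∃ C : ℝ, ∀ (W : WeierstrassCurve ℚ) [W.IsElliptic] [W.IsGloballyMinimal] (N : ℕ) [NeZero N]
      (D : ModularParametrizationData W N),
      (1 - ε) * Real.log N + 2 * W.faltingsHeight - C ≤ Real.log D.modularDegree := by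
  obtain ⟨c, hc, hcN⟩ := hP ε hε
  refine ⟨-Real.log (4 * Real.pi ^ 2 * c), fun W _ _ N _ D => ?_⟩
  have hNpos : (0 : ℝ) < N := by exact_mod_cast Nat.pos_of_ne_zero (NeZero.ne N)
  have hp : 0 < c * (N : ℝ) ^ (1 - ε) := by positivity
  have h := two_mul_faltingsHeight_le_of_petersson D hp (hcN N W D.f D.isNewformOf)
  have hlog : Real.log (4 * Real.pi ^ 2 * (c * (N : ℝ) ^ (1 - ε))) =
      Real.log (4 * Real.pi ^ 2 * c) + (1 - ε) * Real.log N := by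
    rw [← mul_assoc, Real.log_mul (by positivity) (Real.rpow_pos_of_pos hNpos _).ne', Real.log_rpow hNpos]
  rw [hlog] at h
  linarith

/-- **THMDOOR-2a, HYPOTHESIS-FREE form**: the same with exponent `1 − θ` for every `θ > ½`, from the PROVED
Petersson bound `(f,f) ≥ c(θ) N^{1−θ}` (`HoffsteinLockhart1994_peterssonProduct_lower_bound_of_half_lt`, Iwaniec
8.3 + the tree's Rankin–Selberg). [cite: Iwaniec2002, Thm. 8.3] [cite: ZagierCMB1985, §1] -/
theorem log_modularDegree_ge_of_half_lt {θ : ℝ} (hθ : 1 / 2 < θ) :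
    ∃ C : ℝ, ∀ (W : WeierstrassCurve ℚ) [W.IsElliptic] [W.IsGloballyMinimal] (N : ℕ) [NeZero N]
      (D : ModularParametrizationData W N),
      (1 - θ) * Real.log N + 2 * W.faltingsHeight - C ≤ Real.log D.modularDegree := by
  obtain ⟨c, hc, hcN⟩ := HoffsteinLockhart1994_peterssonProduct_lower_bound_of_half_lt hθ
  refine ⟨-Real.log (4 * Real.pi ^ 2 * c), fun W _ _ N _ D => ?_⟩
  have hNpos : (0 : ℝ) < N := by exact_mod_cast Nat.pos_of_ne_zero (NeZero.ne N)
  have hp : 0 < c * (N : ℝ) ^ (1 - θ) := by positivity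
  have h := two_mul_faltingsHeight_le_of_petersson D hp (hcN N W D)
  have hlog : Real.log (4 * Real.pi ^ 2 * (c * (N : ℝ) ^ (1 - θ))) =
      Real.log (4 * Real.pi ^ 2 * c) + (1 - θ) * Real.log N := by
    rw [← mul_assoc, Real.log_mul (by positivity) (Real.rpow_pos_of_pos hNpos _).ne', Real.log_rpow hNpos]
  rw [hlog] at h
  linarith

/-- **Absolute form: `deg φ ≫_ε N^{1−ε}` for every datum of every globally minimal `E/ℚ`**, modulo HL only
(`h_F > −4/3` PROVED): `(1 − ε) log N − C ≤ log deg φ_D`. [cite: MurtyCongruencePrimes1999, §2] [cite: HoffsteinLockhart1994] -/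
theorem log_modularDegree_ge_abs_of_petersson (hP : murty_petersson_newform_lower_bound) {ε : ℝ} (hε : 0 < ε) :
    ∃ C : ℝ, ∀ (W : WeierstrassCurve ℚ) [W.IsElliptic] [W.IsGloballyMinimal] (N : ℕ) [NeZero N]
      (D : ModularParametrizationData W N), (1 - ε) * Real.log N - C ≤ Real.log D.modularDegree := by
  obtain ⟨C, hC⟩ := log_modularDegree_ge_of_petersson hP hε
  refine ⟨C + 8 / 3, fun W _ _ N _ D => ?_⟩
  have h1 := hC W N D
  have h2 := neg_four_thirds_lt_faltingsHeight W
  linarith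

/-- **Absolute form, HYPOTHESIS-FREE: `deg φ ≫_θ N^{1−θ}` for every `θ > ½`** (so `deg φ ≫ N^{1/2 − ε}`
unconditionally; Watkins' printed `N^{7/6−ε}` is stronger but not in the tree). [cite: Iwaniec2002, Thm. 8.3] [cite: ZagierCMB1985, §1] -/
theorem log_modularDegree_ge_abs_of_half_lt {θ : ℝ} (hθ : 1 / 2 < θ) :
    ∃ C : ℝ, ∀ (W : WeierstrassCurve ℚ) [W.IsElliptic] [W.IsGloballyMinimal] (N : ℕ) [NeZero N]
      (D : ModularParametrizationData W N), (1 - θ) * Real.log N - C ≤ Real.log D.modularDegree := by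
  obtain ⟨C, hC⟩ := log_modularDegree_ge_of_half_lt hθ
  refine ⟨C + 8 / 3, fun W _ _ N _ D => ?_⟩
  have h1 := hC W N D
  have h2 := neg_four_thirds_lt_faltingsHeight W
  linarith

/-- **THMDOOR-2b: the congruence number is bounded BELOW**, `log r_f ≥ (1 − ε) log N_E − C(ε)` for the newform
`f` of every globally minimal elliptic `W/ℚ` (datum at level `N_E`), modulo Hoffstein–Lockhart (`hP`) and Ribet's
`m_f ∣ r_f` (`hR`, `modularDegree_dvd_congruenceNumber`, ARS 2012 Thm 2.1); `r_f > 0` is PROVED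
(`congruenceNumber_pos_of_datum`). Proof: the optimal datum `D₀` of the class lives on a globally minimal `W₀`
(`exists_optimal_modularParametrizationData_of_isNewformOf'`, Edixhoven PROVED — no modularity input, the datum
is given); `m_f = deg D₀ ≥ e^{−C} N^{1−ε} e^{2 h_F(W₀)}` (2a) with `h_F(W₀) > −4/3`; `m_f ∣ r_f`. The unconditional
LOWER companion of the conjectural UPPER door `PolyCongruenceNumberRat K` (window `K ≥ 1`) and the baseline
against which the `n′_f`-growth engine (ENG-MSYM) measures. NOT abc.
[cite: AgasheRibetStein2012, Thm. 2.1] [cite: MurtyCongruencePrimes1999, §2] [cite: HoffsteinLockhart1994] -/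
theorem log_congruenceNumber_ge_of_petersson (hP : murty_petersson_newform_lower_bound)
    (hR : modularDegree_dvd_congruenceNumber) {ε : ℝ} (hε : 0 < ε) :
    ∃ C : ℝ, ∀ (W : WeierstrassCurve ℚ) [W.IsElliptic] [W.IsGloballyMinimal] [NeZero (W.conductorNorm ℤ)]
      (D : ModularParametrizationData W (W.conductorNorm ℤ)),
      (1 - ε) * Real.log (W.conductorNorm ℤ) - C ≤ Real.log (congruenceNumber D.f) := by
  obtain ⟨C, hC⟩ := log_modularDegree_ge_abs_of_petersson hP hε
  refine ⟨C, fun W _ _ _ D => ?_⟩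
  obtain ⟨W₀, hW₀, hW₀min, D₀, hf, -, hmin⟩ :=
    Literature.NumberTheory.Automorphic.exists_optimal_modularParametrizationData_of_isNewformOf'
      (W.conductorNorm ℤ) W rfl D.isNewformOf
  haveI := hW₀
  haveI := hW₀min
  have h1 := hC W₀ (W.conductorNorm ℤ) D₀
  have hdvd : D₀.modularDegree ∣ congruenceNumber D₀.f :=
    hR W₀ _ D₀ fun W' _ D' h => hmin W' D' (h.trans hf)
  have hle : (D₀.modularDegree : ℝ) ≤ (congruenceNumber D₀.f : ℝ) := by
    exact_mod_cast Nat.le_of_dvd (congruenceNumber_pos_of_datum D₀) hdvd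
  have hdpos : (0 : ℝ) < D₀.modularDegree := by exact_mod_cast D₀.deg_pos
  rw [← hf]
  exact h1.trans (Real.log_le_log hdpos hle)

/-- **THMDOOR-2b, Petersson-hypothesis-free**: `log r_f ≥ (1 − θ) log N_E − C(θ)` for every `θ > ½`, modulo
Ribet's `m_f ∣ r_f` ONLY. [cite: AgasheRibetStein2012, Thm. 2.1] [cite: Iwaniec2002, Thm. 8.3] -/
theorem log_congruenceNumber_ge_of_half_lt (hR : modularDegree_dvd_congruenceNumber) {θ : ℝ} (hθ : 1 / 2 < θ) :
    ∃ C : ℝ, ∀ (W : WeierstrassCurve ℚ) [W.IsElliptic] [W.IsGloballyMinimal] [NeZero (W.conductorNorm ℤ)]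
      (D : ModularParametrizationData W (W.conductorNorm ℤ)),
      (1 - θ) * Real.log (W.conductorNorm ℤ) - C ≤ Real.log (congruenceNumber D.f) := by
  obtain ⟨C, hC⟩ := log_modularDegree_ge_abs_of_half_lt hθ
  refine ⟨C, fun W _ _ _ D => ?_⟩
  obtain ⟨W₀, hW₀, hW₀min, D₀, hf, -, hmin⟩ :=
    Literature.NumberTheory.Automorphic.exists_optimal_modularParametrizationData_of_isNewformOf'
      (W.conductorNorm ℤ) W rfl D.isNewformOf
  haveI := hW₀
  haveI := hW₀min
  have h1 := hC W₀ (W.conductorNorm ℤ) D₀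
  have hdvd : D₀.modularDegree ∣ congruenceNumber D₀.f :=
    hR W₀ _ D₀ fun W' _ D' h => hmin W' D' (h.trans hf)
  have hle : (D₀.modularDegree : ℝ) ≤ (congruenceNumber D₀.f : ℝ) := by
    exact_mod_cast Nat.le_of_dvd (congruenceNumber_pos_of_datum D₀) hdvd
  have hdpos : (0 : ℝ) < D₀.modularDegree := by exact_mod_cast D₀.deg_pos
  rw [← hf]
  exact h1.trans (Real.log_le_log hdpos hle)

end LowerBounds

end Summit.ABC.Analytic

end
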